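import Summits.PneNP.PneNP.Theorems.KloostermanAssembly
import Literature.Computability.Cryptography.OneWayFunctionsPneNP
import Literature.Computability.Cryptography.LiuPassCondEPPRG

/-!
# Strategy census companion — crux `PlantedRootHardness` (stmt-PneNP-2573), route-PneNP-Kloosterman

Typed material for `STRATEGY-CENSUS.md` (crux-strategist seat `cstrat-stmt-PneNP-2573-r1`, RESTATED deciding crux,
BC2-redirect audit, 2026-08-17). `X := PlantedRootHardness`, `S := PneNP`. Nothing here is a route item; this is a
Cruxes workfile (lean check rc 0, 0 sorries, 0 warnings; seam axioms = propext / Classical.choice / Quot.sound).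

* §E  the ensemble abbreviated (`fam`, `bound`, `instCode`, `plantedCode`, `rootEvent`, `ensembleAvg`, `countAvg`);
      `plantedRootHardness_iff` unfolds X through them by `Iff.rfl`.
* §P  probability toolkit over `RandAlg.pr` (counting form `pr_eq_card_filter_div`): `pr_empty`, `pr_union`, `sum_pr_fiber`.
* §D1 the RABIN SPLIT `X ⇐ H(δ) ∧ N(δ')`, `2δ < δ'`: H = `NonPlantedRootHard δ` (no PPT outputs a NON-planted small root
      except with probability ≤ δ), N = `MultiRootLikely δ'` (a second small root exists with density ≥ δ'); the seam
      `plantedRootHardness_of_rabin` is PROVED (fibre symmetry: `Σ_x pr(dec = x) ≤ #fibres`, and `2·#fibres + #multi ≤ 2c`).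
* §O0 `pneNP_of_X : X → S` (one landed line — the RESTATED signal); §O2 the general law "once the provable partner lands,
      the hardness piece is ≥ X and ≥ S by one line" with its D1 instance.
* §D0 the index-slicing costume `X ⇐ X|_P ∧ X|_{¬P}` with its trivial seam PROVED (`X_of_xOn_compl`) and `xOn_of_X`.
* §S  STRENGTHEN banked: `X_of_negligible : PlantedRootNegligible → X` (item #5 ⇒ item #2).
* §B  bridge splits `T ∧ (T → X)` typed (`CensusBridge`, `NPHardBridge`, `WorstToAvgBridge`, `OWFUniversality`) with their
      mp seams and the two (c)-killing controls `pneNP_of_W`, `pneNP_of_weakOWFExist`.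
* §D2 the decision split typed (`PlantedNullIndist`, `NullRootRare`).
* §V  abbreviation-free signatures of the D1 pieces (`Iff.rfl`) and the seam at the filed constants
      `plantedRootHardness_of_subs : NonPlantedRootHard (1/8) → MultiRootLikely (1/2) → X`.

Probe results are in `ProbesA.lean` (rc 0; 28 sorries = 28 failed cheap probes; by-name controls elaborate).
-/

set_option linter.dupNamespace false
set_option linter.unusedVariables false

namespace Summit.PneNP.PneNP.Cruxes.PlantedRootHardness.StrategyCensus

open _root_.Computability Polynomial Filter Finset
open Literature.Computability.Complexity
open Summit.PneNP.PneNP.Theses.Kloosterman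

/-! ## §E. The ensemble, abbreviated (definitionally the route's literal text) -/

/-- The prime family of the ensemble `D_m`: `m`-subsets of the primes of bit-length `3⌊log₂ m⌋+3`. -/
def fam (m : ℕ) : Finset (Finset ℕ) :=
  ((Finset.Ico (2 ^ (3 * Nat.log 2 m + 2)) (2 ^ (3 * Nat.log 2 m + 3))).filter Nat.Prime).powersetCard m

/-- The modulus `b = ∏ S`. -/
def modulus (S : Finset ℕ) : ℕ := ∏ p ∈ S, p

/-- The planting bound `c = ⌊b / 2^m⌋`. -/
def bound (S : Finset ℕ) (m : ℕ) : ℕ := (∏ p ∈ S, p) / 2 ^ m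

/-- The instance code `⟨code S, ⟨bin a, bin c⟩⟩`. -/
def instCode (S : Finset ℕ) (a c : ℕ) : List Bool :=
  boolPair (encodingListNatBool.encode (S.sort (· ≤ ·))) (boolPair (encodeNat a) (encodeNat c))

/-- The planted instance of `(S, x)` at parameter `m`: `a = x² mod b`, `c = ⌊b/2^m⌋`. -/
def plantedCode (S : Finset ℕ) (m x : ℕ) : List Bool :=
  instCode S (x ^ 2 % ∏ p ∈ S, p) ((∏ p ∈ S, p) / 2 ^ m)

/-- Success event of X: the output decodes to SOME root of `x²` below `c`. -/
def rootEvent (S : Finset ℕ) (m x : ℕ) : Set (List Bool) :=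
  {w | decodeNat w < (∏ p ∈ S, p) / 2 ^ m ∧ decodeNat w ^ 2 ≡ x ^ 2 [MOD ∏ p ∈ S, p]}

/-- The normalised double average of an event family over the ensemble `D_m` (the shape of X's left side). -/
noncomputable def ensembleAvg (B : RandAlg (List Bool) (List Bool)) (m : ℕ)
    (E : Finset ℕ → ℕ → ℕ → Set (List Bool)) : ℝ :=
  (∑ S ∈ fam m, (∑ x ∈ range (bound S m), B.pr id (plantedCode S m x) (E S m x)) /
    (((bound S m : ℕ)) : ℝ)) / ((fam m).card : ℝ)

/-- A normalised double average of a counting statistic over `D_m` (the shape of the number-theoretic pieces). -/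
noncomputable def countAvg (m : ℕ) (M : Finset ℕ → ℕ → Finset ℕ) : ℝ :=
  (∑ S ∈ fam m, ((M S m).card : ℝ) / (((bound S m : ℕ)) : ℝ)) / ((fam m).card : ℝ)

/-- `X` unfolded through the abbreviations (definitional). -/
theorem plantedRootHardness_iff :
    PlantedRootHardness ↔
      ∃ q : Polynomial ℕ, (∀ n, 0 < q.eval n) ∧ ∀ B : RandAlg (List Bool) (List Bool),
        B.IsPolyTime (id : List Bool → List Bool) (id : List Bool → List Bool) →
          ∀ᶠ m : ℕ in atTop, ensembleAvg B m rootEvent ≤ 1 - 1 / ((q.eval m : ℕ) : ℝ) :=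
  Iff.rfl


/-! ## §P. Probability toolkit: `RandAlg.pr` as a normalised count; additivity; fibres -/

section Toolkit

variable {α β : Type}

/-- The empty event has probability `0`. -/
theorem pr_empty (A : RandAlg α β) (ea : α → List Bool) (x : α) : A.pr ea x (∅ : Set β) = 0 := by
  classical
  rw [A.pr_eq_card_filter_div ea x (∅ : Set β) rfl]
  simp

/-- Finite additivity of `RandAlg.pr` on two disjoint events (counting coin strings). -/
theorem pr_union (A : RandAlg α β) (ea : α → List Bool) (x : α) {E F : Set β} (h : Disjoint E F) :
    A.pr ea x (E ∪ F) = A.pr ea x E + A.pr ea x F := by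
  classical
  set n := A.coinLen (ea x).length with hn
  rw [A.pr_eq_card_filter_div ea x (E ∪ F) hn.symm, A.pr_eq_card_filter_div ea x E hn.symm,
    A.pr_eq_card_filter_div ea x F hn.symm, ← add_div]
  have hfilter : (Finset.univ.filter fun r : List.Vector Bool n => A.run x r.toList ∈ E ∪ F) =
      (Finset.univ.filter fun r : List.Vector Bool n => A.run x r.toList ∈ E) ∪
        (Finset.univ.filter fun r : List.Vector Bool n => A.run x r.toList ∈ F) := by
    ext r
    simp [Finset.mem_filter, Set.mem_union]
  have hdisj : Disjoint (Finset.univ.filter fun r : List.Vector Bool n => A.run x r.toList ∈ E)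
      (Finset.univ.filter fun r : List.Vector Bool n => A.run x r.toList ∈ F) := by
    rw [Finset.disjoint_filter]
    intro r _ hE hF
    exact Set.disjoint_left.1 h hE hF
  rw [hfilter, Finset.card_union_of_disjoint hdisj, Nat.cast_add]

/-- Fibre identity: summing the probabilities of the singleton-fibre events `{w | g w = y}` over `y ∈ F` gives the
probability of `{w | g w ∈ F}`. -/
theorem sum_pr_fiber (A : RandAlg α β) (ea : α → List Bool) (x : α) {γ : Type} [DecidableEq γ]
    (g : β → γ) (F : Finset γ) :
    ∑ y ∈ F, A.pr ea x {w | g w = y} = A.pr ea x {w | g w ∈ F} := by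
  classical
  induction F using Finset.induction_on with
  | empty => simp [pr_empty]
  | insert a s ha ih =>
    rw [Finset.sum_insert ha, ih]
    have hdisj : Disjoint {w : β | g w = a} {w : β | g w ∈ s} := by
      rw [Set.disjoint_left]
      rintro w (rfl : g w = a) (hw : g w ∈ s)
      exact ha hw
    rw [← pr_union A ea x hdisj]
    congr 1
    ext w
    simp [Set.mem_union]

end Toolkit

/-! ## §D1. The Rabin split `X ⇐ H(δ) ∧ N(δ')` (`2δ < δ'`): typed pieces and the PROVED seam

H = `NonPlantedRootHard δ`: no PPT algorithm, given a planted instance `(S, x² mod b, c)`, outputs a root below `c`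
OTHER than the planted `x`, except with ensemble-average probability `≤ δ` (eventually in `m`).
N = `MultiRootLikely δ'`: eventually the ensemble-average density of planted points `x < c` whose square has a
SECOND root below `c` is `≥ δ'` (pure number theory: multiplicity of small square roots; Poisson heuristics give
`1 - 1/e`).  Seam (Rabin's symmetry argument, M. O. Rabin 1979, here WITHOUT the factoring pay-off since the
factorisation is public): conditional on the instance, the planted `x` is uniform on its fibre, so an inverter that
finds SOME small root finds a NON-planted one with probability `≥ success − #fibres/c`; and `#fibres ≤ c − #multi/2`.
-/

/-- Event of H: the output decodes to a root below `c` other than the planted `x`. -/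
def otherRootEvent (S : Finset ℕ) (m x : ℕ) : Set (List Bool) :=
  {w | decodeNat w < (∏ p ∈ S, p) / 2 ^ m ∧ decodeNat w ≠ x ∧ decodeNat w ^ 2 ≡ x ^ 2 [MOD ∏ p ∈ S, p]}

/-- **H(δ)** `NonPlantedRootHard δ` (hardness piece of the Rabin split). -/
def NonPlantedRootHard (δ : ℝ) : Prop :=
  ∀ B : RandAlg (List Bool) (List Bool),
    B.IsPolyTime (id : List Bool → List Bool) (id : List Bool → List Bool) →
      ∀ᶠ m : ℕ in atTop, ensembleAvg B m otherRootEvent ≤ δ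

/-- The planted points `x < c` whose square has another root below `c`. -/
def multiRoots (S : Finset ℕ) (m : ℕ) : Finset ℕ :=
  (range (bound S m)).filter fun x => ∃ z ∈ range (bound S m), z ≠ x ∧ z ^ 2 ≡ x ^ 2 [MOD ∏ p ∈ S, p]

/-- **N(δ')** `MultiRootLikely δ'` (number-theoretic piece of the Rabin split). -/
def MultiRootLikely (δ' : ℝ) : Prop :=
  ∀ᶠ m : ℕ in atTop, δ' ≤ countAvg m multiRoots

/-- For `x < c` the success event splits: `root = otherRoot ∪ {dec = x}`. -/
theorem rootEvent_eq_union (S : Finset ℕ) (m x : ℕ) (hx : x < bound S m) :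
    rootEvent S m x = otherRootEvent S m x ∪ {w | decodeNat w = x} := by
  ext w
  simp only [rootEvent, otherRootEvent, Set.mem_setOf_eq, Set.mem_union]
  constructor
  · rintro ⟨h1, h2⟩
    by_cases h : decodeNat w = x
    · exact Or.inr h
    · exact Or.inl ⟨h1, h, h2⟩
  · rintro (⟨h1, -, h2⟩ | h)
    · exact ⟨h1, h2⟩
    · rw [h]
      exact ⟨hx, Nat.ModEq.refl _⟩

/-- The two parts are disjoint. -/
theorem disjoint_otherRootEvent_single (S : Finset ℕ) (m x : ℕ) :
    Disjoint (otherRootEvent S m x) {w | decodeNat w = x} := by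
  rw [Set.disjoint_left]
  rintro w ⟨-, h, -⟩ (h' : decodeNat w = x)
  exact h h'

/-- Pointwise: `pr(root) = pr(otherRoot) + pr(dec = x)` on the planted instance of `x < c`. -/
theorem pr_rootEvent_eq (B : RandAlg (List Bool) (List Bool)) (S : Finset ℕ) (m x : ℕ) (hx : x < bound S m) :
    B.pr id (plantedCode S m x) (rootEvent S m x) =
      B.pr id (plantedCode S m x) (otherRootEvent S m x) + B.pr id (plantedCode S m x) {w | decodeNat w = x} := by
  rw [rootEvent_eq_union S m x hx, pr_union _ _ _ (disjoint_otherRootEvent_single S m x)]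

/-- Rabin's symmetry step: `Σ_{x<c} pr_{x² mod b}(dec = x) ≤ #{x² mod b : x < c}` — regroup by fibres of
`x ↦ x² mod b` (the instance only depends on the fibre), apply the fibre identity and `pr ≤ 1`. -/
theorem sum_pr_single_le_card_image (B : RandAlg (List Bool) (List Bool)) (S : Finset ℕ) (m : ℕ) :
    ∑ x ∈ range (bound S m), B.pr id (plantedCode S m x) {w | decodeNat w = x}
      ≤ (((range (bound S m)).image fun x => x ^ 2 % ∏ p ∈ S, p).card : ℝ) := by
  classical
  set c := bound S m with hc
  set sq : ℕ → ℕ := fun x => x ^ 2 % ∏ p ∈ S, p with hsq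
  have hmaps : ∀ x ∈ range c, sq x ∈ (range c).image sq := fun x hx => Finset.mem_image_of_mem sq hx
  rw [← Finset.sum_fiberwise_of_maps_to hmaps]
  calc ∑ a ∈ (range c).image sq, ∑ x ∈ (range c).filter (fun x => sq x = a),
          B.pr id (plantedCode S m x) {w | decodeNat w = x}
      = ∑ a ∈ (range c).image sq, ∑ x ∈ (range c).filter (fun x => sq x = a),
          B.pr id (instCode S a c) {w | decodeNat w = x} := by
        refine Finset.sum_congr rfl fun a _ => Finset.sum_congr rfl fun x hx => ?_
        rw [Finset.mem_filter] at hx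
        rw [← hx.2]
        exact rfl
    _ = ∑ a ∈ (range c).image sq,
          B.pr id (instCode S a c) {w | decodeNat w ∈ (range c).filter (fun x => sq x = a)} := by
        refine Finset.sum_congr rfl fun a _ => ?_
        rw [sum_pr_fiber]
    _ ≤ ∑ a ∈ (range c).image sq, (1 : ℝ) := Finset.sum_le_sum fun a _ => B.pr_le_one _ _ _
    _ = _ := by simp

/-- Fibre combinatorics: `2·#{x² mod b : x < c} + #multiRoots ≤ 2c` (a fibre of size `1` carries no multi-root
point, a fibre of size `k ≥ 2` carries `k ≤ 2k − 2` of them). -/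
theorem two_mul_card_image_add_card_multiRoots_le (S : Finset ℕ) (m : ℕ) :
    2 * ((range (bound S m)).image fun x => x ^ 2 % ∏ p ∈ S, p).card + (multiRoots S m).card
      ≤ 2 * bound S m := by
  classical
  set c := bound S m with hc
  set sq : ℕ → ℕ := fun x => x ^ 2 % ∏ p ∈ S, p with hsq
  have hsub : multiRoots S m ⊆ range c := Finset.filter_subset _ _
  have hfib : ∑ a ∈ (range c).image sq, ((range c).filter (fun x => sq x = a)).card = c := by
    rw [← Finset.card_eq_sum_card_fiberwise (fun x hx => Finset.mem_image_of_mem sq hx), Finset.card_range]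
  have hmulti : (multiRoots S m).card =
      ∑ a ∈ (range c).image sq, ((multiRoots S m).filter (fun x => sq x = a)).card :=
    Finset.card_eq_sum_card_fiberwise fun x hx => Finset.mem_image_of_mem sq (hsub hx)
  have himg : 2 * ((range c).image sq).card = ∑ a ∈ (range c).image sq, 2 := by simp [mul_comm]
  have hper : ∀ a ∈ (range c).image sq,
      2 + ((multiRoots S m).filter (fun x => sq x = a)).card ≤ 2 * ((range c).filter (fun x => sq x = a)).card := by
    intro a ha
    obtain ⟨x₀, hx₀, rfl⟩ := Finset.mem_image.1 ha
    have hMsub : (multiRoots S m).filter (fun x => sq x = sq x₀) ⊆ (range c).filter (fun x => sq x = sq x₀) :=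
      Finset.filter_subset_filter _ hsub
    have hle := Finset.card_le_card hMsub
    have hpos : 1 ≤ ((range c).filter (fun x => sq x = sq x₀)).card :=
      Finset.card_pos.2 ⟨x₀, Finset.mem_filter.2 ⟨hx₀, rfl⟩⟩
    by_cases h2 : 2 ≤ ((range c).filter (fun x => sq x = sq x₀)).card
    · omega
    · -- the fibre is the singleton {x₀}: no multi-root point lies in it
      have hM0 : ((multiRoots S m).filter (fun x => sq x = sq x₀)).card = 0 := by
        rw [Finset.card_eq_zero, Finset.filter_eq_empty_iff]
        intro x hx hxa
        rw [multiRoots, Finset.mem_filter] at hx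
        obtain ⟨hxc, z, hz, hzx, hzmod⟩ := hx
        have hzF : z ∈ (range c).filter (fun x => sq x = sq x₀) := by
          refine Finset.mem_filter.2 ⟨hz, ?_⟩
          rw [← hxa]
          exact hzmod
        have hxF : x ∈ (range c).filter (fun x => sq x = sq x₀) := Finset.mem_filter.2 ⟨hxc, hxa⟩
        have : 2 ≤ ((range c).filter (fun x => sq x = sq x₀)).card := by
          have hpair : ({z, x} : Finset ℕ) ⊆ (range c).filter (fun x => sq x = sq x₀) := by
            intro y hy
            rw [Finset.mem_insert, Finset.mem_singleton] at hy
            rcases hy with rfl | rfl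
            · exact hzF
            · exact hxF
          have := Finset.card_le_card hpair
          rwa [Finset.card_pair hzx] at this
        exact h2 this
      omega
  calc 2 * ((range c).image sq).card + (multiRoots S m).card
      = ∑ a ∈ (range c).image sq, (2 + ((multiRoots S m).filter (fun x => sq x = a)).card) := by
        rw [himg, hmulti, ← Finset.sum_add_distrib]
    _ ≤ ∑ a ∈ (range c).image sq, 2 * ((range c).filter (fun x => sq x = a)).card := Finset.sum_le_sum hper
    _ = 2 * c := by rw [← Finset.mul_sum, hfib]

/-- Per-`S` form of the seam: `Σ_x pr(root) ≤ Σ_x pr(otherRoot) + c − #multiRoots/2`. -/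
theorem sum_pr_root_le (B : RandAlg (List Bool) (List Bool)) (S : Finset ℕ) (m : ℕ) :
    ∑ x ∈ range (bound S m), B.pr id (plantedCode S m x) (rootEvent S m x)
      ≤ ∑ x ∈ range (bound S m), B.pr id (plantedCode S m x) (otherRootEvent S m x)
          + (bound S m : ℝ) - ((multiRoots S m).card : ℝ) / 2 := by
  have hsplit : ∑ x ∈ range (bound S m), B.pr id (plantedCode S m x) (rootEvent S m x)
      = ∑ x ∈ range (bound S m), B.pr id (plantedCode S m x) (otherRootEvent S m x)
        + ∑ x ∈ range (bound S m), B.pr id (plantedCode S m x) {w | decodeNat w = x} := by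
    rw [← Finset.sum_add_distrib]
    exact Finset.sum_congr rfl fun x hx => pr_rootEvent_eq B S m x (Finset.mem_range.1 hx)
  have himg := sum_pr_single_le_card_image B S m
  have hcomb := two_mul_card_image_add_card_multiRoots_le S m
  have hcomb' : (2 : ℝ) * ((range (bound S m)).image fun x => x ^ 2 % ∏ p ∈ S, p).card
      + ((multiRoots S m).card : ℝ) ≤ 2 * (bound S m : ℝ) := by exact_mod_cast hcomb
  rw [hsplit]
  linarith

/-- Normalised per-`S` form: `A_S ≤ O_S + 1 − M_S/2` (junk-safe: all three vanish when `c = 0`). -/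
theorem avg_pr_root_le (B : RandAlg (List Bool) (List Bool)) (S : Finset ℕ) (m : ℕ) :
    (∑ x ∈ range (bound S m), B.pr id (plantedCode S m x) (rootEvent S m x)) / (((bound S m : ℕ)) : ℝ)
      ≤ (∑ x ∈ range (bound S m), B.pr id (plantedCode S m x) (otherRootEvent S m x)) / (((bound S m : ℕ)) : ℝ)
          + 1 - (((multiRoots S m).card : ℝ) / (((bound S m : ℕ)) : ℝ)) / 2 := by
  rcases Nat.eq_zero_or_pos (bound S m) with h0 | hpos
  · have hM : multiRoots S m = ∅ := by
      rw [multiRoots, h0]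
      simp
    simp [h0, hM]
  · have hc : (0 : ℝ) < (((bound S m : ℕ)) : ℝ) := by exact_mod_cast hpos
    have h := sum_pr_root_le B S m
    rw [div_le_iff₀ hc]
    have e : ((∑ x ∈ range (bound S m), B.pr id (plantedCode S m x) (otherRootEvent S m x)) / (((bound S m : ℕ)) : ℝ)
          + 1 - (((multiRoots S m).card : ℝ) / (((bound S m : ℕ)) : ℝ)) / 2) * (((bound S m : ℕ)) : ℝ)
        = ∑ x ∈ range (bound S m), B.pr id (plantedCode S m x) (otherRootEvent S m x)
          + (bound S m : ℝ) - ((multiRoots S m).card : ℝ) / 2 := by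
      field_simp
      try ring
    rw [e]
    exact h

/-- Ensemble form: `avg(root) ≤ avg(otherRoot) + 1 − countAvg(multiRoots)/2` whenever the prime family is non-empty. -/
theorem ensembleAvg_root_le (B : RandAlg (List Bool) (List Bool)) (m : ℕ) (hfam : 0 < (fam m).card) :
    ensembleAvg B m rootEvent ≤ ensembleAvg B m otherRootEvent + 1 - countAvg m multiRoots / 2 := by
  have hN : (0 : ℝ) < ((fam m).card : ℝ) := by exact_mod_cast hfam
  unfold ensembleAvg countAvg
  rw [div_le_iff₀ hN]
  have e : ((∑ S ∈ fam m, (∑ x ∈ range (bound S m), B.pr id (plantedCode S m x) (otherRootEvent S m x)) /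
        (((bound S m : ℕ)) : ℝ)) / ((fam m).card : ℝ) + 1 -
        (∑ S ∈ fam m, ((multiRoots S m).card : ℝ) / (((bound S m : ℕ)) : ℝ)) / ((fam m).card : ℝ) / 2) *
        ((fam m).card : ℝ)
      = ∑ S ∈ fam m, ((∑ x ∈ range (bound S m), B.pr id (plantedCode S m x) (otherRootEvent S m x)) /
        (((bound S m : ℕ)) : ℝ) + 1 - (((multiRoots S m).card : ℝ) / (((bound S m : ℕ)) : ℝ)) / 2) := by
    rw [Finset.sum_sub_distrib, Finset.sum_add_distrib, Finset.sum_const, nsmul_eq_mul, mul_one, ← Finset.sum_div]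
    field_simp
    try ring
  rw [e]
  exact Finset.sum_le_sum fun S _ => avg_pr_root_le B S m

/-- **Seam of the Rabin split (PROVED):** `NonPlantedRootHard δ → MultiRootLikely δ' → PlantedRootHardness`
for `2δ < δ'`, with the constant polynomial `q = k`, `1/k ≤ δ'/2 − δ`. -/
theorem plantedRootHardness_of_rabin {δ δ' : ℝ} (hδ : 2 * δ < δ') (hH : NonPlantedRootHard δ)
    (hN : MultiRootLikely δ') : PlantedRootHardness := by
  obtain ⟨k, hk⟩ := exists_nat_one_div_lt (show 0 < δ' / 2 - δ by linarith)
  refine ⟨Polynomial.C (k + 1), fun n => by simp, fun B hB => ?_⟩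
  filter_upwards [hH B hB, hN] with m hHm hNm
  change ensembleAvg B m rootEvent ≤ 1 - 1 / (((Polynomial.C (k + 1) : Polynomial ℕ).eval m : ℕ) : ℝ)
  rw [Polynomial.eval_C]
  push_cast
  rcases Nat.eq_zero_or_pos (fam m).card with h0 | hpos
  · have hA : ensembleAvg B m rootEvent = 0 := by
      unfold ensembleAvg
      rw [h0]
      simp
    rw [hA]
    have : (1 : ℝ) / ((k : ℝ) + 1) ≤ 1 := by
      rw [div_le_one (by positivity)]
      have hk0 := Nat.cast_nonneg (α := ℝ) k
      linarith
    linarith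
  · have key := ensembleAvg_root_le B m hpos
    linarith

/-! ## §O0. The RESTATED signal: `X → S` is one landed line -/

/-- `X → PneNP` (the route's proved Assembly item stmt-PneNP-2582). -/
theorem pneNP_of_X (hX : PlantedRootHardness) : PneNP :=
  Summit.PneNP.PneNP.Theorems.kloosterman_assembly_proof hX

/-! ## §O2. General laws: once the provable partner lands, the hardness piece is ≥ X and ≥ S by one line -/

/-- If the seam `A → B → X` is proved and the partner `A` is proved, the other piece gives X alone. -/
theorem piece_ge_X_of_landed_partner {A B : Prop} (seam : A → B → PlantedRootHardness) (hA : A) :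
    B → PlantedRootHardness :=
  seam hA

/-- … and gives the summit alone (compose with §O0). For the Rabin split: the day `MultiRootLikely δ'` lands,
`NonPlantedRootHard δ → PneNP` is this one line, i.e. H is RESTATED by the same audit that flagged X. -/
theorem piece_ge_S_of_landed_partner {A B : Prop} (seam : A → B → PlantedRootHardness) (hA : A) : B → PneNP :=
  fun hB => pneNP_of_X (seam hA hB)

/-- Instance for the Rabin split (the partner `N` as an explicit hypothesis). -/
theorem pneNP_of_nonPlantedRootHard_of_multiRootLikely {δ δ' : ℝ} (hδ : 2 * δ < δ') (hN : MultiRootLikely δ') :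
    NonPlantedRootHard δ → PneNP :=
  piece_ge_S_of_landed_partner (fun hN' hH => plantedRootHardness_of_rabin hδ hH hN') hN

/-! ## §D0. The index-slicing costume: `X ⇐ X|_P ∧ X|_{¬P}` (trivial seam PROVED; each half is X in truth) -/

/-- X asserted only along the parameters `m` with `P m`. -/
def XOn (P : ℕ → Prop) : Prop :=
  ∃ q : Polynomial ℕ, (∀ n, 0 < q.eval n) ∧ ∀ B : RandAlg (List Bool) (List Bool),
    B.IsPolyTime (id : List Bool → List Bool) (id : List Bool → List Bool) →
      ∀ᶠ m : ℕ in atTop, P m → ensembleAvg B m rootEvent ≤ 1 - 1 / ((q.eval m : ℕ) : ℝ)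

/-- X is `XOn ⊤`. -/
theorem xOn_true_iff : XOn (fun _ => True) ↔ PlantedRootHardness := by
  constructor
  · rintro ⟨q, hq, h⟩
    exact ⟨q, hq, fun B hB => (h B hB).mono fun m hm => hm trivial⟩
  · rintro ⟨q, hq, h⟩
    exact ⟨q, hq, fun B hB => (h B hB).mono fun m hm _ => hm⟩

/-- X restricts to every index class (each slice is a CONSEQUENCE of X). -/
theorem xOn_of_X (P : ℕ → Prop) (hX : PlantedRootHardness) : XOn P := by
  obtain ⟨q, hq, h⟩ := hX
  exact ⟨q, hq, fun B hB => (h B hB).mono fun m hm _ => hm⟩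

/-- The costume seam (PROVED, ~15 lines of bookkeeping): two complementary slices give X, with `q = q₁ + q₂`. -/
theorem X_of_xOn_compl (P : ℕ → Prop) (h₁ : XOn P) (h₂ : XOn fun m => ¬ P m) : PlantedRootHardness := by
  obtain ⟨q₁, hq₁, h₁⟩ := h₁
  obtain ⟨q₂, hq₂, h₂⟩ := h₂
  refine ⟨q₁ + q₂, fun n => by rw [Polynomial.eval_add]; exact Nat.add_pos_left (hq₁ n) _, fun B hB => ?_⟩
  filter_upwards [h₁ B hB, h₂ B hB] with m hm₁ hm₂
  change ensembleAvg B m rootEvent ≤ 1 - 1 / (((q₁ + q₂).eval m : ℕ) : ℝ)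
  rw [Polynomial.eval_add]
  push_cast
  have e₁ : (0 : ℝ) < ((q₁.eval m : ℕ) : ℝ) := by exact_mod_cast hq₁ m
  have e₂ : (0 : ℝ) < ((q₂.eval m : ℕ) : ℝ) := by exact_mod_cast hq₂ m
  have b₁ : 1 / (((q₁.eval m : ℕ) : ℝ) + ((q₂.eval m : ℕ) : ℝ)) ≤ 1 / ((q₁.eval m : ℕ) : ℝ) :=
    one_div_le_one_div_of_le e₁ (by linarith)
  have b₂ : 1 / (((q₁.eval m : ℕ) : ℝ) + ((q₂.eval m : ℕ) : ℝ)) ≤ 1 / ((q₂.eval m : ℕ) : ℝ) :=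
    one_div_le_one_div_of_le e₂ (by linarith)
  by_cases hP : P m
  · have := hm₁ hP
    linarith
  · have := hm₂ hP
    linarith

/-! ## §S. STRENGTHEN is banked: `PlantedRootNegligible → X` (item #5 ⇒ item #2; `k = 1`, not a decomposition) -/

/-- Negligible success implies weak hardness with `q = 2` (from exponent `k = 1` and `m ≥ 2`). -/
theorem X_of_negligible (h : PlantedRootNegligible) : PlantedRootHardness := by
  refine ⟨Polynomial.C 2, fun n => by simp, fun B hB => ?_⟩
  filter_upwards [h B hB 1, eventually_ge_atTop 2] with m hm hm2
  change ensembleAvg B m rootEvent ≤ 1 / (m : ℝ) ^ 1 at hm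
  change ensembleAvg B m rootEvent ≤ 1 - 1 / (((Polynomial.C 2 : Polynomial ℕ).eval m : ℕ) : ℝ)
  rw [Polynomial.eval_C]
  push_cast
  have hm2' : (2 : ℝ) ≤ m := by exact_mod_cast hm2
  have : 1 / (m : ℝ) ^ 1 ≤ 1 / 2 := by
    rw [pow_one]
    exact one_div_le_one_div_of_le (by norm_num) hm2'
  linarith

/-! ## §B. Bridge splits `T ∧ (T → X)`: seams are modus ponens; the implication piece is X in disguise or barred -/

/-- Census bridge: the number-theoretic census (item #3, open, provable in kind) ⇒ X. Seam = mp (`trivial_seam`).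
Fails (d): "census ⇒ hardness against all PPT" has no mechanism (pseudo-solutions are not solutions, so the census has no
information-theoretic content; it bounds lattice ENUMERATION only); and the day #3 lands it IS X (§O2). -/
def CensusBridge : Prop := TernaryPseudoSolutions → PlantedRootHardness

/-- mp seam of the census bridge. -/
theorem X_of_censusBridge (hT : TernaryPseudoSolutions) (hB : CensusBridge) : PlantedRootHardness := hB hT

/-- NP-hardness bridge: worst-case NP-hardness of the squarefree slice (item #4, open) ⇒ average-case weak one-wayness.
Seam = mp. The implication piece is an NP-hardness-to-one-way-function transfer: non-adaptive black-box proofs of it put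
`coNP ⊆ AM` (`Literature.Barriers.PneNP.NPHardnessToOneWayFunctions`, AGGM 2006 Thm 4 / Bogdanov–Trevisan 2006); no
random self-reduction in `x` exists (`a ↦ a·u²` destroys smallness); fails (d), and ≡ X once #4 lands (§O2). -/
def NPHardBridge : Prop := SqfreeQCNPHard → PlantedRootHardness

/-- mp seam of the NP-hardness bridge. -/
theorem X_of_npHardBridge (h4 : SqfreeQCNPHard) (hB : NPHardBridge) : PlantedRootHardness := hB h4

/-- Worst-to-average bridge: `W ⇒ X` (random self-reducibility of small roots — unknown and implausible: the only
multiplicative symmetry `a ↦ a·u²` does not preserve `x < c`). -/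
def WorstToAvgBridge : Prop := SqfreeRootSearchHard → PlantedRootHardness

/-- mp seam of the worst-to-average bridge. -/
theorem X_of_worstToAvgBridge (hW : SqfreeRootSearchHard) (hB : WorstToAvgBridge) : PlantedRootHardness := hB hW

/-- (c) fails for the partner `W` at once: `W → S` is the landed glue stmt-PneNP-2579. -/
theorem pneNP_of_W (hW : SqfreeRootSearchHard) : PneNP :=
  Summit.PneNP.PneNP.Theorems.kloosterman_worstCaseToSummit_proof hW

/-- OWF-universality split: `X ⇐ WeakOWFExist ∧ (WeakOWFExist → X)` ("planted small roots are a universal weak one-way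
function", Levin 1987 shape; tree: `LevinUniversalOWF.isWeaklyOneWay_levinUniv_of_OWFExist_holds` for Levin's
ARTIFICIAL function). The implication piece would be the first OWF-completeness theorem for a natural algebraic function
(distribution-preserving reductions into a FIXED ensemble `D_m` — the obstacle of Levin's theory); no plan (d). -/
def OWFUniversality : Prop := Literature.Computability.Cryptography.WeakOWFExist → PlantedRootHardness

/-- (c) fails for the partner `WeakOWFExist` at once: it gives S alone by a landed theorem. -/
theorem pneNP_of_weakOWFExist (h : Literature.Computability.Cryptography.WeakOWFExist) : PneNP :=
  Literature.Computability.Cryptography.pneNP_shape_of_WeakOWFExist h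

/-! ## §D2. The decision split `X ⇐ D(η) ∧ N₀(π)` (`η + π + slack < 1`): typed; seam provable like §D1; fails (d) as §D1 -/

/-- Null instance of `(S, y)`, `y` uniform modulo `b`: `a = y² mod b` (a uniform square), same `c`. -/
def nullCode (S : Finset ℕ) (m y : ℕ) : List Bool :=
  instCode S (y ^ 2 % ∏ p ∈ S, p) ((∏ p ∈ S, p) / 2 ^ m)

/-- Acceptance event of a test with string output: it answers `[true]`. -/
def acceptEvent : Set (List Bool) := {w | w = [true]}

/-- Ensemble-average acceptance of a test on PLANTED instances. -/
noncomputable def plantedAccept (T : RandAlg (List Bool) (List Bool)) (m : ℕ) : ℝ :=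
  ensembleAvg T m fun _ _ _ => acceptEvent

/-- Ensemble-average acceptance of a test on NULL instances (inner average over `y < b`). -/
noncomputable def nullAccept (T : RandAlg (List Bool) (List Bool)) (m : ℕ) : ℝ :=
  (∑ S ∈ fam m, (∑ y ∈ range (∏ p ∈ S, p), T.pr id (nullCode S m y) acceptEvent) / ((∏ p ∈ S, p : ℕ) : ℝ)) /
    ((fam m).card : ℝ)

/-- **D(η)** `PlantedNullIndist η`: no PPT test tells planted squares from uniform squares with advantage `> η`,
eventually (a DECISION hardness piece; the information-theoretic optimum is the small-root-existence test, advantage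
`≈ P_null[no root < c] ≈ 1/e`, so `η` must sit below it — a hand-picked threshold, typing checklist (iv)). -/
def PlantedNullIndist (η : ℝ) : Prop :=
  ∀ T : RandAlg (List Bool) (List Bool),
    T.IsPolyTime (id : List Bool → List Bool) (id : List Bool → List Bool) →
      ∀ᶠ m : ℕ in atTop, plantedAccept T m - nullAccept T m ≤ η

/-- Null points `y < b` whose square has SOME root below `c`. -/
def nullSmallRoot (S : Finset ℕ) (m : ℕ) : Finset ℕ :=
  (range (∏ p ∈ S, p)).filter fun y => ∃ z ∈ range (bound S m), z ^ 2 ≡ y ^ 2 [MOD ∏ p ∈ S, p]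

/-- **N₀(π)** `NullRootRare π`: eventually the ensemble-average density of uniform squares having a root below `c` is
`≤ π` (number theory; Poisson heuristics `1 − 1/e`). With D(η), an X-solver of success `> 1 − 1/q` yields the test
"run it, accept iff the output is a root below c" of advantage `≥ 1 − 1/q − π`, contradicting D when `η + π < 1 − 1/q`. -/
def NullRootRare (π : ℝ) : Prop :=
  ∀ᶠ m : ℕ in atTop,
    (∑ S ∈ fam m, ((nullSmallRoot S m).card : ℝ) / ((∏ p ∈ S, p : ℕ) : ℝ)) / ((fam m).card : ℝ) ≤ π

/-! ## §V. Verbatim (abbreviation-free) signatures of the two D1 pieces, as they would be filed (definitional check) -/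

/-- `NonPlantedRootHard (1/8)` in route style (no census abbreviations). -/
theorem nonPlantedRootHard_iff_verbatim :
    NonPlantedRootHard (1 / 8) ↔
      ∀ B : Literature.Computability.Complexity.RandAlg (List Bool) (List Bool), B.IsPolyTime (id : List Bool → List Bool) (id : List Bool → List Bool) → ∀ᶠ m : ℕ in Filter.atTop, let fam : Finset (Finset ℕ) := ((Finset.Ico (2 ^ (3 * Nat.log 2 m + 2)) (2 ^ (3 * Nat.log 2 m + 3))).filter Nat.Prime).powersetCard m; (∑ S ∈ fam, (∑ x ∈ Finset.range ((∏ p ∈ S, p) / 2 ^ m), B.pr id (Literature.Computability.Complexity.boolPair (Literature.Computability.Complexity.encodingListNatBool.encode (S.sort (· ≤ ·))) (Literature.Computability.Complexity.boolPair (Computability.encodeNat (x ^ 2 % ∏ p ∈ S, p)) (Computability.encodeNat ((∏ p ∈ S, p) / 2 ^ m)))) {w | Computability.decodeNat w < (∏ p ∈ S, p) / 2 ^ m ∧ Computability.decodeNat w ≠ x ∧ Computability.decodeNat w ^ 2 ≡ x ^ 2 [MOD ∏ p ∈ S, p]}) / ((((∏ p ∈ S, p) / 2 ^ m : ℕ))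 : ℝ)) / (fam.card : ℝ) ≤ 1 / 8 :=
  Iff.rfl

/-- `MultiRootLikely (1/2)` in route style (no census abbreviations). -/
theorem multiRootLikely_iff_verbatim :
    MultiRootLikely (1 / 2) ↔
      ∀ᶠ m : ℕ in Filter.atTop, let fam : Finset (Finset ℕ) := ((Finset.Ico (2 ^ (3 * Nat.log 2 m + 2)) (2 ^ (3 * Nat.log 2 m + 3))).filter Nat.Prime).powersetCard m; (1 / 2 : ℝ) ≤ (∑ S ∈ fam, (((Finset.range ((∏ p ∈ S, p) / 2 ^ m)).filter fun x => ∃ z ∈ Finset.range ((∏ p ∈ S, p) / 2 ^ m), z ≠ x ∧ z ^ 2 ≡ x ^ 2 [MOD ∏ p ∈ S, p]).card : ℝ) / ((((∏ p ∈ S, p) / 2 ^ m : ℕ)) : ℝ)) / (fam.card : ℝ) :=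
  Iff.rfl

/-- The D1 seam at the filed constants: `NonPlantedRootHard (1/8) → MultiRootLikely (1/2) → X`. -/
theorem plantedRootHardness_of_subs (hH : NonPlantedRootHard (1 / 8)) (hN : MultiRootLikely (1 / 2)) :
    PlantedRootHardness :=
  plantedRootHardness_of_rabin (by norm_num) hH hN

end Summit.PneNP.PneNP.Cruxes.PlantedRootHardness.StrategyCensus
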